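import Summits.QuantumFields.BalabanUV.T4Continuum.Spine.NE9.DirectPairingRunLimitSharp

/-!
# T⁴ programme, spine estimate NE9 — KING'S CURRENCY, THE LAST UNIFORMITY: NON-VACUITY OF THE STABILISATION ROUTE — a run-DEPENDENT,
# STABILISING, NEVER eventually-constant family of local terms on the run tower for which EVERY binder of
# `DirectPairingRunLimit.king_U6_of_stabilising_shapes` holds and the King-currency END fires — census item C35 (rider) of cell
# `pub-balaban-gaps`, seat ne9 (gen 8); companion of `DirectPairingRunLimit` ∕ `DirectPairingRunLimitSharp`

Cell `pub-balaban-gaps` (YM blitz G2, seat ne9, unit `pub-balaban-gaps-ne9-g8`; record `run/shared/lean/pub/pub-balaban-gaps/ne/NE9.md` §5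
row C35).  Summits-side bookkeeping; two WITNESS definitions (`convTerm`, `convEm`) on the run tower `DirectPairingRunLimitSharp.runTower`;
nothing of Bałaban's asserted.

WHY.  `DirectPairingRunLimit` offers three sources for the volume-uniformity of the per-shape modulus: (a) EXACT LOCALITY (the run-indexed
local functions eventually constant), (b) STABILISATION in the run, (c) a volume-uniform quantitative modulus; gen 7's
`sepUCshape_of_compact` is the constant case of (a).  `DirectPairingRunLimitSharp` showed the clause cannot be dropped.  This file shows
that (b) is INHABITED STRICTLY BEYOND (a) with every inequality non-trivial: on the run tower (domain `n` born in run `n`, one shape of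
tree length `0`) the terms `sin((1 − 2^{−n})·g_{young})` — frequencies converging as the torus grows, never equal for two runs —
* §1 satisfy `TowerNE5On` (`C₅ = 1`), prefix dependence and the bound (`towerNE5On_convTerm`, `prefix_convTerm`, `bound_convTerm`);
* §2 factor at every scale through the one-point compact space of local data with per-run jointly continuous `convEm σ m k`
  (`convEm_continuousOn`, `convTerm_fac`) which STABILISE in the run (`convEm_stabilising`: `|sin(a_k c) − sin(a_{K₀} c)| ≤ 6·2^{−(K₀−m)}`
  on the cube `[0, 6]^m`) and are NOT eventually constant (`convEm_not_eventuallyEq`: `sin` is injective on `[0, 1]`) — source (b), not (a);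
* §3 hence `DirectPairingRunLimit.king_U6_of_stabilising_shapes` APPLIES BY NAME (`king_U6_convTerm`): with node U2's data `t K ≡ 1`, `p ≡ 0`
  there is a scale profile `b_j → 0` dominating every direct bracket of the runs `K`, `K + n`, and `T4CauchySum.delta E₀ ρ inj K → 0` for every
  injection under it.  The binders of C35's END are jointly satisfiable by a genuinely run-dependent family.

HONEST FRAMING: a toy witness on abstract carriers; nothing of Bałaban's construction is modelled; which of (a)∕(b)∕(c) Bałaban's localized
representation affords is a READING of [Balaban1988RG2Cluster] §2 that only the one-step object (W1) settles; tower-NE5 ∕ NE9 NOT PRINTED ∕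
NOT PROVED; spine PROVED 0∕9 unchanged; ONE FIXED finite four-torus; NOT UV stability, NOT the continuum limit, NOT infinite volume, NOT a
mass gap, NOT Clay.  Classification of NE9 UNCHANGED in kind (WORK-bound on W1; instance 0∕1).

References (TYPES only): [Balaban1987RG1] = T. Bałaban, Commun. Math. Phys. **109** (1987) 249–301, Thm 1 p. 259, p. 263; [Balaban1988RG2Cluster]
= T. Bałaban, Commun. Math. Phys. **116** (1988) 1–22, pp. 13–14; [King1986] = C. King, Commun. Math. Phys. **102** (1986) 649–677, §3.2.
-/

namespace Summit.QuantumFields.BalabanUV.T4Continuum.NE9.DirectPairingRunLimitWitness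

open scoped BigOperators
open Finset Filter Topology Metric Set
open Literature.MathematicalPhysics.QuantumFieldTheory.Balaban1983to89
open Literature.MathematicalPhysics.QuantumFieldTheory.Balaban1983to89.T4CouplingAnalyticity (BoxWindow)
open T4CauchySum (delta)
open Summit.QuantumFields.BalabanUV.T4Continuum.NE9.TowerCarriers
open Summit.QuantumFields.BalabanUV.T4Continuum.NE9.TowerCarriersBox (TowerNE5On)
open Summit.QuantumFields.BalabanUV.T4Continuum.NE9.DirectPairingRunLimit (king_U6_of_stabilising_shapes)
open Summit.QuantumFields.BalabanUV.T4Continuum.NE9.DirectPairingRunLimitSharp (runTower)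

/-! ## §1 The convergent run family on the run tower: tower-NE5, prefix dependence, the bound -/

/-- The frequency of the domain born in run `n`: `a n = 1 − 2^{−n} ∈ [0, 1[`, converging to `1`, injective in `n`. [folklore] -/
noncomputable def freq (n : ℕ) : ℝ := 1 - (1 / 2 : ℝ) ^ n

/-- `0 ≤ a n ≤ 1`. [folklore] -/
theorem freq_mem (n : ℕ) : 0 ≤ freq n ∧ freq n ≤ 1 := by
  unfold freq
  constructor
  · have h : (1 / 2 : ℝ) ^ n ≤ 1 := pow_le_one₀ (by norm_num) (by norm_num)
    linarith
  · have h : 0 ≤ (1 / 2 : ℝ) ^ n := by positivity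
    linarith

/-- WITNESS TERMS: in run `k` the domain `n` (scale `k − n`) carries `sin(a_n·g_{k−n−1})`, `a_n = 1 − 2^{−n}` (the youngest coupling, a
frequency converging as the birth run — the torus — grows), and `0` at scale `0`. [folklore] -/
noncomputable def convTerm : ℕ → (ℕ → ℝ) → Unit → ℕ → ℝ :=
  fun k g _ n => if n < k then Real.sin (freq n * g (k - n - 1)) else 0

/-- Above scale `0` the term reads the youngest coupling. [folklore] -/
theorem convTerm_of_lt {k n : ℕ} (h : n < k) (g : ℕ → ℝ) (U : Unit) :
    convTerm k g U n = Real.sin (freq n * g (k - n - 1)) := by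
  simp [convTerm, h]

/-- At scale `0` (and for unborn domains) the term vanishes. [folklore] -/
theorem convTerm_of_not_lt {k n : ℕ} (h : ¬ n < k) (g : ℕ → ℝ) (U : Unit) : convTerm k g U n = 0 := by
  simp [convTerm, h]

/-- **TOWER-NE5 HOLDS** (`C₅ = 1`, any `θ ≥ 0`): above scale `0` the youngest coupling has the same age in both runs, at scale `0` `|sin| ≤ 1`.
[folklore] -/
theorem towerNE5On_convTerm (I : Set ℝ) (κ : ℝ) {θ : ℝ} (hθ : 0 ≤ θ) : TowerNE5On runTower convTerm I κ θ 1 := by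
  intro k b _ g _ U n
  change ℕ at n
  show |convTerm k g U n - convTerm (k + 1) (prepend b g) U n| ≤ 1 * θ ^ (k - n) * Real.exp (-(κ * (0 : ℝ)))
  rw [mul_zero, neg_zero, Real.exp_zero, mul_one, one_mul]
  by_cases h : n < k
  · rw [convTerm_of_lt h, convTerm_of_lt (by omega)]
    have e : prepend b g (k + 1 - n - 1) = g (k - n - 1) := by
      rw [show k + 1 - n - 1 = (k - n - 1) + 1 by omega, prepend_succ]
    rw [e, sub_self, abs_zero]
    exact pow_nonneg hθ _
  · rw [convTerm_of_not_lt h]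
    by_cases h' : n < k + 1
    · rw [convTerm_of_lt h', zero_sub, abs_neg, show k - n = 0 by omega, pow_zero]
      exact Real.abs_sin_le_one _
    · rw [convTerm_of_not_lt h', sub_self, abs_zero]
      exact pow_nonneg hθ _

/-- **PREFIX DEPENDENCE HOLDS.** [folklore] -/
theorem prefix_convTerm (I : Set ℝ) :
    ∀ (k : ℕ) (U : runTower.B) (X : runTower.Dom), ∀ g ∈ BoxWindow I, ∀ g' ∈ BoxWindow I,
      (∀ i, i < k - runTower.r X → g i = g' i) → convTerm k g U X = convTerm k g' U X := by
  intro k U n g _ g' _ hagree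
  change ℕ at n
  by_cases h : n < k
  · rw [convTerm_of_lt h, convTerm_of_lt h, hagree (k - n - 1) (by show k - n - 1 < k - n; omega)]
  · rw [convTerm_of_not_lt h, convTerm_of_not_lt h]

/-- **THE BOUND HOLDS** with `B = 1`. [folklore] -/
theorem bound_convTerm (κ : ℝ) (I : Set ℝ) :
    ∀ (k : ℕ) (U : runTower.B) (X : runTower.Dom), ∀ g ∈ BoxWindow I,
      Real.exp (κ * runTower.d X) * |convTerm k g U X| ≤ 1 := by
  intro k U n g _
  change ℕ at n
  show Real.exp (κ * 0) * |convTerm k g U n| ≤ 1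
  rw [mul_zero, Real.exp_zero, one_mul]
  by_cases h : n < k
  · rw [convTerm_of_lt h]; exact Real.abs_sin_le_one _
  · rw [convTerm_of_not_lt h, abs_zero]; exact zero_le_one

/-! ## §2 Per scale: the run-indexed local functions — jointly continuous, stabilising, never eventually constant -/

/-- THE RUN-INDEXED LOCAL FUNCTIONS at scale `m`: `convEm σ m k c u = sin(a_{k−m}·c_{m−1})` (`m ≥ 1`; `0` at scale `0`). [folklore] -/
noncomputable def convEm (_σ : Unit) (m k : ℕ) (c : Fin m → ℝ) (_u : Unit) : ℝ :=
  if h : 0 < m then Real.sin (freq (k - m) * c ⟨m - 1, by omega⟩) else 0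

/-- Each `convEm σ m k` is jointly continuous (on any set). [folklore] -/
theorem convEm_continuousOn (σ : Unit) (m k : ℕ) (S : Set ((Fin m → ℝ) × Unit)) :
    ContinuousOn (fun p : (Fin m → ℝ) × Unit => convEm σ m k p.1 p.2) S := by
  apply Continuous.continuousOn
  by_cases hm : 0 < m
  · simp only [convEm, dif_pos hm]
    fun_prop
  · simp only [convEm, dif_neg hm]
    exact continuous_const

/-- **STABILISATION IN THE RUN**: on the cube `[0, 6]^m`, `|convEm σ m k − convEm σ m K₀| ≤ 6·2^{−(K₀−m)}` for `k ≥ K₀ ≥ m`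
(`|sin x − sin y| ≤ |x − y|`, `|a_{k−m} − a_{K₀−m}| ≤ 2^{−(K₀−m)}`), so the family is uniformly Cauchy in the run. [folklore] -/
theorem convEm_stabilising (σ : Unit) (m : ℕ) :
    ∀ ε : ℝ, 0 < ε → ∃ K₀ : ℕ, ∀ k, K₀ ≤ k →
      ∀ q ∈ (Set.univ.pi fun _ : Fin m => Icc (0 : ℝ) 6) ×ˢ (Set.univ : Set Unit),
        |convEm σ m k q.1 q.2 - convEm σ m K₀ q.1 q.2| ≤ ε := by
  intro ε hε
  by_cases hm : 0 < m
  · -- `(1/2)^N ≤ ε / 6` for large `N`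
    obtain ⟨N, hN⟩ := ((tendsto_order.1 (tendsto_pow_atTop_nhds_zero_of_lt_one (by norm_num : (0 : ℝ) ≤ 1 / 2)
      (by norm_num : (1 / 2 : ℝ) < 1))).2 (ε / 6) (by positivity)).exists_forall_of_atTop
    refine ⟨N + m, fun k hk q hq => ?_⟩
    obtain ⟨c, u⟩ := q
    have hc : c ⟨m - 1, by omega⟩ ∈ Icc (0 : ℝ) 6 := hq.1 ⟨m - 1, by omega⟩ (Set.mem_univ _)
    simp only [convEm, dif_pos hm]
    have hfreq : |freq (k - m) - freq (N + m - m)| ≤ (1 / 2 : ℝ) ^ N := by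
      rw [Nat.add_sub_cancel]
      unfold freq
      rw [show (1 : ℝ) - (1 / 2) ^ (k - m) - (1 - (1 / 2) ^ N) = (1 / 2) ^ N - (1 / 2) ^ (k - m) by ring]
      have h1 : (1 / 2 : ℝ) ^ (k - m) ≤ (1 / 2) ^ N := pow_le_pow_of_le_one (by norm_num) (by norm_num) (by omega)
      have h2 : 0 ≤ (1 / 2 : ℝ) ^ (k - m) := by positivity
      rw [abs_of_nonneg (by linarith)]
      linarith
    calc |Real.sin (freq (k - m) * c ⟨m - 1, by omega⟩) - Real.sin (freq (N + m - m) * c ⟨m - 1, by omega⟩)|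
        ≤ |freq (k - m) * c ⟨m - 1, by omega⟩ - freq (N + m - m) * c ⟨m - 1, by omega⟩| := Real.abs_sin_sub_sin_le _ _
      _ = |freq (k - m) - freq (N + m - m)| * |c ⟨m - 1, by omega⟩| := by rw [← sub_mul, abs_mul]
      _ ≤ (1 / 2 : ℝ) ^ N * 6 := by
          refine mul_le_mul hfreq ?_ (abs_nonneg _) (by positivity)
          rw [abs_of_nonneg hc.1]; exact hc.2
      _ ≤ ε / 6 * 6 := mul_le_mul_of_nonneg_right (hN N le_rfl).le (by norm_num)
      _ = ε := by ring
  · exact ⟨0, fun k _ q _ => by simp only [convEm, dif_neg hm, sub_self, abs_zero]; exact hε.le⟩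

/-- **NOT EVENTUALLY CONSTANT** (source (b), not (a)): at scale `1` the runs `k₀` and `k₀ + 2` give different local functions at `c₀ = 1`
(`sin` is injective on `[0, 1] ⊆ [−π∕2, π∕2]` and `a_{k₀+1} ≠ a_{k₀−1}`). [folklore] -/
theorem convEm_not_eventuallyEq :
    ¬ ∃ k₀ : ℕ, ∀ k, k₀ ≤ k → ∀ p ∈ (Set.univ.pi fun _ : Fin 1 => Icc (0 : ℝ) 6) ×ˢ (Set.univ : Set Unit),
        convEm () 1 k p.1 p.2 = convEm () 1 k₀ p.1 p.2 := by
  rintro ⟨k₀, h⟩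
  have hmem : ((fun _ : Fin 1 => (1 : ℝ)), ()) ∈ (Set.univ.pi fun _ : Fin 1 => Icc (0 : ℝ) 6) ×ˢ (Set.univ : Set Unit) :=
    ⟨fun _ _ => ⟨by norm_num, by norm_num⟩, Set.mem_univ _⟩
  have key := h (k₀ + 2) (by omega) _ hmem
  have e1 : convEm () 1 (k₀ + 2) (fun _ : Fin 1 => (1 : ℝ)) () = Real.sin (freq (k₀ + 1)) := by
    simp only [convEm, Nat.zero_lt_one, dif_pos, mul_one, show k₀ + 2 - 1 = k₀ + 1 by omega]
  have e2 : convEm () 1 k₀ (fun _ : Fin 1 => (1 : ℝ)) () = Real.sin (freq (k₀ - 1)) := by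
    simp only [convEm, Nat.zero_lt_one, dif_pos, mul_one]
  rw [e1, e2] at key
  have hI : ∀ n, freq n ∈ Icc (-(Real.pi / 2)) (Real.pi / 2) := fun n => by
    obtain ⟨h0, h1⟩ := freq_mem n
    constructor <;> nlinarith [Real.pi_gt_three]
  have heq := Real.injOn_sin (hI _) (hI _) key
  unfold freq at heq
  have hlt : (1 / 2 : ℝ) ^ (k₀ + 1) < (1 / 2) ^ (k₀ - 1) :=
    pow_lt_pow_right_of_lt_one₀ (by norm_num) (by norm_num) (by omega)
  linarith

/-- The factorisation hypothesis of `DirectPairingRunLimit.king_U6_of_stabilising_shapes` on the run tower: local datum `()` in the compact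
`univ`, normalised term `= convEm σ m k (g|_{<m}) ()` at every scale. [folklore] -/
theorem convTerm_fac (κ : ℝ) (I : Set ℝ) :
    ∀ (σ : Unit) (m k : ℕ) (U : runTower.B) (X : runTower.Dom), (fun _ : runTower.Dom => ()) X = σ → runTower.r X + m = k →
      (fun (_ : ℕ) (_ : runTower.B) (_ : runTower.Dom) => ()) k U X ∈ (fun (_ : Unit) (_ : ℕ) => (Set.univ : Set Unit)) σ m ∧
        ∀ g ∈ BoxWindow I, Real.exp (κ * runTower.d X) * convTerm k g U X = convEm σ m k (fun l => g l) () := by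
  intro σ m k U n _ hn
  change ℕ at n
  change n + m = k at hn
  refine ⟨Set.mem_univ _, fun g _ => ?_⟩
  show Real.exp (κ * 0) * convTerm k g U n = convEm σ m k (fun l => g l) ()
  rw [mul_zero, Real.exp_zero, one_mul]
  by_cases hm : 0 < m
  · rw [convTerm_of_lt (by omega)]
    simp only [convEm, dif_pos hm]
    rw [show k - m = n by omega, show k - n - 1 = m - 1 by omega]
  · rw [convTerm_of_not_lt (by omega)]
    simp only [convEm, dif_neg hm]

/-! ## §3 The King-currency END fires on the convergent run family, BY NAME -/

/-- **NON-VACUITY OF C35's END**: every binder of `DirectPairingRunLimit.king_U6_of_stabilising_shapes` holds on the run tower with the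
convergent run family (tower-NE5 `C₅ = 1`, `θ = 0`; prefix dependence; bound `B = 1`; one shape of tree length `0`; compact local data
`univ : Set Unit`; per-run joint continuity; stabilisation; factorisation; node U2's data `t K ≡ 1`, `p ≡ 0`), so for every `κ' < κ` there
is a scale profile `b_j → 0` dominating every direct bracket of the runs `K`, `K + n` and `T4CauchySum.delta E₀ ρ inj K → 0` for every injection
under it — with a run-DEPENDENT family that stabilises and is never eventually constant (§2). [folklore] -/
theorem king_U6_convTerm {κ κ' : ℝ} (hκ : κ' < κ) :
    ∃ b : ℕ → ℝ, (∀ j, 0 ≤ b j) ∧ Tendsto b atTop (𝓝 0) ∧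
      (∀ (K n : ℕ) (U : runTower.B) (X : runTower.Dom), runTower.r X ≤ K →
        |convTerm (K + n) (fun _ => 1) U X - convTerm K (fun _ => 1) (runTower.descend (K + n) U K) X| ≤
          b (K - runTower.r X) * Real.exp (-(κ' * runTower.d X))) ∧
      ∀ (E₀ ρ : ℝ) (inj : ℕ → ℕ → ℝ), 0 ≤ E₀ → 0 ≤ ρ → ρ < 1 →
        (∀ K j : ℕ, j ≤ K → 0 ≤ inj K j ∧ inj K j ≤ b j) → Tendsto (delta E₀ ρ inj) atTop (𝓝 0) :=
  king_U6_of_stabilising_shapes runTower (I := Icc (0 : ℝ) 6) (t := fun _ _ => (1 : ℝ)) (p := fun _ => 0)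
    (fun _ => ()) (fun _ => 0) (fun _ => rfl) (fun _ => Set.toFinite _)
    zero_le_one le_rfl zero_lt_one hκ (towerNE5On_convTerm (Icc (0 : ℝ) 6) κ le_rfl) (prefix_convTerm _)
    zero_le_one (bound_convTerm κ _) (fun _ _ => (Set.univ : Set Unit)) (fun _ _ => isCompact_univ) (subset_refl _)
    convEm (fun σ m k => convEm_continuousOn σ m k _) (fun σ m => convEm_stabilising σ m) (fun _ _ _ => ())
    (convTerm_fac κ (Icc (0 : ℝ) 6)) (fun _ _ => ⟨by norm_num, by norm_num⟩)
    (fun _ _ => by rw [sub_self, abs_zero]) (fun _ => le_rfl) summable_zero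

end Summit.QuantumFields.BalabanUV.T4Continuum.NE9.DirectPairingRunLimitWitness
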